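import Mathlib
import HarnessLib

/-!
# Venture YMGap — the ANCHORED moment–cumulant recursion: truncated (Ursell) functions of every order,
# their vanishing under decoupled moments and Lipschitz dependence on the moments (the split lemma)

HONEST FRAMING: venture file of the cell `pub-ymgap` (QuantumFields programme), seat ds-1 (gen 12).  Pure finite
combinatorics / probability bookkeeping — no lattice, no number, nothing about the continuum or the Clay problem.  It is
the algebra layer of the object «C-SMOOTH» (all-orders tree decay of the truncated functions of the strong-coupling state
⇒ the state and the free energy are `C^∞` in the coupling; sibling files `TruncatedTreeDecay`, `CouplingSmooth`).

For a «moment function» `m : Finset ι → ℝ` (think `m T = E[∏_{i ∈ T} X_i]`) and an ANCHOR `a`, the anchored cumulant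
`ac m a T` is defined by the recursion over the proper subsets of `T` containing `a`
(`m T = Σ_{a ∈ B ⊆ T} ac m a B · m (T \ B)`, i.e. `ac m a T = m T − Σ_{a ∈ B ⊊ T} ac m a B · m (T \ B)`), which is the
classical moment–cumulant formula solved for the top cumulant; for `a ∈ T` it IS the joint cumulant `u_{|T|}` of
`(X_i)_{i ∈ T}` (we never need this identification, only the four structural facts below, so no partition lattice /
Möbius inversion enters):
* `sum_ac_mul_eq` — the recursion identity; `ac_congr` — `ac m a T` depends only on `m` below `T`;
* `abs_ac_le` / `abs_ac_sub_ac_le` — a priori bound and LIPSCHITZ dependence on the moments, constant `cumBound |T|`;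
* ★ `ac_eq_zero_of_factor` — if the moments FACTORISE across a bipartition `T = T_p ⊔ T_{¬p}` separating two occupied
  parts, the anchored cumulant vanishes (independent blocks have no mixed cumulants); hence the SPLIT LEMMA
  ★ `abs_ac_le_of_split`: `|ac m a S| ≤ cumBound |S| · ε · ∏ b` when every mixed moment factorises up to `ε ∏ b`;
The CALCULUS of `ac` (linearisation `dac`, chain rule, series, the fresh-slot identity «the derivative of the `n`-th
truncated function is the `(n+1)`-st») and the measure-level vocabulary (`slots`, `mom`, `trunc`) are in the sibling
file `CumulantCalculus`.

References (mechanism only): B. Simon, *The Statistical Mechanics of Lattice Gases* I (1993), §II.12 (Ursell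
functions); T. P. Speed, Austral. J. Statist. 25 (1983) 378 (moment–cumulant recursion); M. Duneau, D. Iagolnitzer,
B. Souillard, CMP 31 (1973) 191 (tree decay from clustering).
-/

noncomputable section

open Finset MeasureTheory Filter Topology

namespace Summit.Ventures.YMGap.Cumulants

variable {ι : Type*} [DecidableEq ι]

/-! ### §1 Anchored proper subsets and the anchored cumulant -/

/-- The proper subsets of `T` containing the anchor `a` (index set of the moment–cumulant recursion). -/
def apsub (a : ι) (T : Finset ι) : Finset (Finset ι) :=
  T.powerset.filter fun B => a ∈ B ∧ B ≠ T

/-- Membership in `apsub`. -/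
theorem mem_apsub {a : ι} {T B : Finset ι} : B ∈ apsub a T ↔ B ⊆ T ∧ a ∈ B ∧ B ≠ T := by
  simp [apsub, Finset.mem_filter, Finset.mem_powerset]

/-- Members of `apsub a T` are strict subsets of `T`. -/
theorem ssubset_of_mem_apsub {a : ι} {T B : Finset ι} (h : B ∈ apsub a T) : B ⊂ T :=
  Finset.ssubset_iff_subset_ne.2 ⟨(mem_apsub.1 h).1, (mem_apsub.1 h).2.2⟩

/-- Members of `apsub a T` have fewer elements than `T`. -/
theorem card_lt_of_mem_apsub {a : ι} {T B : Finset ι} (h : B ∈ apsub a T) : B.card < T.card :=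
  Finset.card_lt_card (ssubset_of_mem_apsub h)

/-- `apsub a T` has at most `2^{|T|}` members. -/
theorem card_apsub_le (a : ι) (T : Finset ι) : ((apsub a T).card : ℝ) ≤ 2 ^ T.card := by
  have h : (apsub a T).card ≤ 2 ^ T.card :=
    (Finset.card_filter_le _ _).trans (Finset.card_powerset T).le
  exact_mod_cast h

/-- Without the anchor there is nothing to recurse on. -/
theorem apsub_eq_empty_of_not_mem {a : ι} {T : Finset ι} (ha : a ∉ T) : apsub a T = ∅ := by
  ext B
  simp only [mem_apsub, Finset.notMem_empty, iff_false]
  rintro ⟨hBT, haB, -⟩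
  exact ha (hBT haB)

/-- **The anchored cumulant** of the moment function `m` at the set `T`, anchor `a`:
`ac m a T = m T − Σ_{B ∈ apsub a T} ac m a B · m (T \ B)` (well-founded recursion on `|T|`).  For `a ∈ T` and
`m T = E[∏_{i∈T} X_i]` this is the joint cumulant of `(X_i)_{i ∈ T}`. [folklore] -/
def ac (m : Finset ι → ℝ) (a : ι) (T : Finset ι) : ℝ :=
  m T - ∑ B ∈ (apsub a T).attach, ac m a B.1 * m (T \ B.1)
termination_by T.card
decreasing_by exact card_lt_of_mem_apsub B.2

/-- The defining recursion of `ac`, with a plain `Finset.sum`. -/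
theorem ac_eq (m : Finset ι → ℝ) (a : ι) (T : Finset ι) :
    ac m a T = m T - ∑ B ∈ apsub a T, ac m a B * m (T \ B) := by
  rw [ac, Finset.sum_attach (apsub a T) (fun B => ac m a B * m (T \ B))]

/-- Off the anchor the anchored cumulant is the bare moment. -/
theorem ac_of_not_mem {m : Finset ι → ℝ} {a : ι} {T : Finset ι} (ha : a ∉ T) : ac m a T = m T := by
  rw [ac_eq, apsub_eq_empty_of_not_mem ha, Finset.sum_empty, sub_zero]

/-- **The moment–cumulant recursion**: for `a ∈ T` and `m ∅ = 1`,
`Σ_{a ∈ B ⊆ T} ac m a B · m (T \ B) = m T`. [folklore] -/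
theorem sum_ac_mul_eq (m : Finset ι → ℝ) {a : ι} {T : Finset ι} (h1 : m ∅ = 1) (ha : a ∈ T) :
    ∑ B ∈ T.powerset.filter (fun B => a ∈ B), ac m a B * m (T \ B) = m T := by
  have hsplit : T.powerset.filter (fun B => a ∈ B) = insert T (apsub a T) := by
    ext B
    simp only [Finset.mem_filter, Finset.mem_powerset, Finset.mem_insert, mem_apsub]
    constructor
    · rintro ⟨hBT, haB⟩
      by_cases h : B = T
      · exact Or.inl h
      · exact Or.inr ⟨hBT, haB, h⟩
    · rintro (rfl | ⟨hBT, haB, -⟩)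
      · exact ⟨subset_rfl, ha⟩
      · exact ⟨hBT, haB⟩
  have hT : T ∉ apsub a T := fun h => (mem_apsub.1 h).2.2 rfl
  rw [hsplit, Finset.sum_insert hT, Finset.sdiff_self, h1, mul_one, ac_eq]
  ring

/-- `ac m a T` depends only on the values of `m` on subsets of `T`. -/
theorem ac_congr {m m' : Finset ι → ℝ} (a : ι) {S : Finset ι} (h : ∀ T ⊆ S, m T = m' T) :
    ∀ T ⊆ S, ac m a T = ac m' a T := by
  intro T
  induction T using Finset.strongInduction with
  | H T ih =>
    intro hTS
    rw [ac_eq, ac_eq, h T hTS]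
    congr 1
    refine Finset.sum_congr rfl fun B hB => ?_
    rw [ih B (ssubset_of_mem_apsub hB) ((mem_apsub.1 hB).1.trans hTS),
      h (T \ B) (Finset.sdiff_subset.trans hTS)]

/-! ### §2 A priori bound and Lipschitz dependence on the moments -/

/-- The constants of the a priori / Lipschitz bounds: `c₀ = 1`, `c_{k+1} = 1 + 2^{k+2} c_k`. -/
def cumBound : ℕ → ℝ
  | 0 => 1
  | k + 1 => 1 + 2 ^ (k + 2) * cumBound k

/-- `cumBound k ≥ 1`. -/
theorem one_le_cumBound : ∀ k, 1 ≤ cumBound k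
  | 0 => le_rfl
  | k + 1 => by
    have h := one_le_cumBound k
    show (1 : ℝ) ≤ 1 + 2 ^ (k + 2) * cumBound k
    nlinarith [pow_pos (show (0 : ℝ) < 2 by norm_num) (k + 2)]

/-- `cumBound k > 0`. -/
theorem cumBound_pos (k : ℕ) : 0 < cumBound k := zero_lt_one.trans_le (one_le_cumBound k)

/-- The successor step of `cumBound` absorbs `1 + 2^{k+1}·(c_k + c_k)`. -/
theorem cumBound_succ_ge (k : ℕ) : 1 + 2 ^ (k + 1) * (cumBound k + cumBound k) ≤ cumBound (k + 1) := by
  show 1 + 2 ^ (k + 1) * (cumBound k + cumBound k) ≤ 1 + 2 ^ (k + 2) * cumBound k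
  rw [pow_succ 2 (k + 1)]
  linarith

/-- **A priori bound**: if `|m T| ≤ ∏_{i∈T} b_i` below `S`, then `|ac m a T| ≤ cumBound |T| · ∏_{i∈T} b_i`
(cumulative form: `|T| ≤ k ⇒ … ≤ cumBound k · ∏ b`). [folklore] -/
theorem abs_ac_le_of_card_le {m : Finset ι → ℝ} {S : Finset ι} {b : ι → ℝ} (hb : ∀ i, 0 ≤ b i)
    (hm : ∀ T ⊆ S, |m T| ≤ ∏ i ∈ T, b i) (a : ι) :
    ∀ (k : ℕ) (T : Finset ι), T ⊆ S → T.card ≤ k → |ac m a T| ≤ cumBound k * ∏ i ∈ T, b i := by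
  intro k
  induction k with
  | zero =>
    intro T hTS hT0
    have hT : T = ∅ := Finset.card_eq_zero.1 (Nat.le_zero.1 hT0)
    subst hT
    rw [ac_of_not_mem (Finset.notMem_empty a)]
    simpa [cumBound] using hm ∅ hTS
  | succ k ih =>
    intro T hTS hTk
    have hP : 0 ≤ ∏ i ∈ T, b i := Finset.prod_nonneg fun i _ => hb i
    have hterm : ∀ B ∈ apsub a T, |ac m a B * m (T \ B)| ≤ cumBound k * ∏ i ∈ T, b i := by
      intro B hB
      have hBT := (mem_apsub.1 hB).1
      have hcard : B.card ≤ k := Nat.lt_succ_iff.1 ((card_lt_of_mem_apsub hB).trans_le hTk)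
      rw [abs_mul]
      calc |ac m a B| * |m (T \ B)| ≤ (cumBound k * ∏ i ∈ B, b i) * ∏ i ∈ T \ B, b i :=
            mul_le_mul (ih B (hBT.trans hTS) hcard) (hm _ (Finset.sdiff_subset.trans hTS)) (abs_nonneg _)
              (mul_nonneg (cumBound_pos k).le (Finset.prod_nonneg fun i _ => hb i))
        _ = cumBound k * ∏ i ∈ T, b i := by
            rw [mul_assoc, mul_comm (∏ i ∈ B, b i), Finset.prod_sdiff hBT]
    rw [ac_eq]
    calc |m T - ∑ B ∈ apsub a T, ac m a B * m (T \ B)|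
        ≤ |m T| + |∑ B ∈ apsub a T, ac m a B * m (T \ B)| := abs_sub _ _
      _ ≤ (∏ i ∈ T, b i) + ∑ B ∈ apsub a T, |ac m a B * m (T \ B)| :=
          add_le_add (hm T hTS) (Finset.abs_sum_le_sum_abs _ _)
      _ ≤ (∏ i ∈ T, b i) + ∑ B ∈ apsub a T, cumBound k * ∏ i ∈ T, b i := by
          gcongr with B hB
          exact hterm B hB
      _ = (∏ i ∈ T, b i) + (apsub a T).card * (cumBound k * ∏ i ∈ T, b i) := by
          rw [Finset.sum_const, nsmul_eq_mul]
      _ ≤ (∏ i ∈ T, b i) + 2 ^ (k + 1) * (cumBound k * ∏ i ∈ T, b i) := by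
          gcongr
          · exact mul_nonneg (cumBound_pos k).le hP
          · exact (card_apsub_le a T).trans (pow_le_pow_right₀ (by norm_num) hTk)
      _ ≤ cumBound (k + 1) * ∏ i ∈ T, b i := by
          have h := cumBound_succ_ge k
          have hc := (cumBound_pos k).le
          nlinarith [mul_nonneg (mul_nonneg (pow_nonneg (show (0:ℝ) ≤ 2 by norm_num) (k + 1)) hc) hP]

/-- **A priori bound** (non-cumulative form). [folklore] -/
theorem abs_ac_le {m : Finset ι → ℝ} {S : Finset ι} {b : ι → ℝ} (hb : ∀ i, 0 ≤ b i)
    (hm : ∀ T ⊆ S, |m T| ≤ ∏ i ∈ T, b i) (a : ι) {T : Finset ι} (hTS : T ⊆ S) :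
    |ac m a T| ≤ cumBound T.card * ∏ i ∈ T, b i :=
  abs_ac_le_of_card_le hb hm a T.card T hTS le_rfl

/-- **Lipschitz dependence on the moments** (cumulative form): if `|m T|, |m̃ T| ≤ ∏_T b` and
`|m T − m̃ T| ≤ ε ∏_T b` below `S`, then `|ac m a T − ac m̃ a T| ≤ cumBound k · ε · ∏_T b` for `|T| ≤ k`. [folklore] -/
theorem abs_ac_sub_ac_le_of_card_le {m m' : Finset ι → ℝ} {S : Finset ι} {b : ι → ℝ} {ε : ℝ}
    (hb : ∀ i, 0 ≤ b i) (hε : 0 ≤ ε)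
    (hm : ∀ T ⊆ S, |m T| ≤ ∏ i ∈ T, b i) (hm' : ∀ T ⊆ S, |m' T| ≤ ∏ i ∈ T, b i)
    (hd : ∀ T ⊆ S, |m T - m' T| ≤ ε * ∏ i ∈ T, b i) (a : ι) :
    ∀ (k : ℕ) (T : Finset ι), T ⊆ S → T.card ≤ k →
      |ac m a T - ac m' a T| ≤ cumBound k * ε * ∏ i ∈ T, b i := by
  intro k
  induction k with
  | zero =>
    intro T hTS hT0
    have hT : T = ∅ := Finset.card_eq_zero.1 (Nat.le_zero.1 hT0)
    subst hT
    rw [ac_of_not_mem (Finset.notMem_empty a), ac_of_not_mem (Finset.notMem_empty a)]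
    simpa [cumBound] using hd ∅ hTS
  | succ k ih =>
    intro T hTS hTk
    have hP : 0 ≤ ∏ i ∈ T, b i := Finset.prod_nonneg fun i _ => hb i
    have hck := (cumBound_pos k).le
    have hterm : ∀ B ∈ apsub a T,
        |ac m a B * m (T \ B) - ac m' a B * m' (T \ B)| ≤ (cumBound k + cumBound k) * ε * ∏ i ∈ T, b i := by
      intro B hB
      have hBT := (mem_apsub.1 hB).1
      have hBS := hBT.trans hTS
      have hDS : T \ B ⊆ S := Finset.sdiff_subset.trans hTS
      have hcard : B.card ≤ k := Nat.lt_succ_iff.1 ((card_lt_of_mem_apsub hB).trans_le hTk)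
      have hPB : 0 ≤ ∏ i ∈ B, b i := Finset.prod_nonneg fun i _ => hb i
      have hPD : 0 ≤ ∏ i ∈ T \ B, b i := Finset.prod_nonneg fun i _ => hb i
      have e : (∏ i ∈ B, b i) * ∏ i ∈ T \ B, b i = ∏ i ∈ T, b i := by
        rw [mul_comm, Finset.prod_sdiff hBT]
      have h1 : |ac m a B - ac m' a B| * |m (T \ B)| ≤ (cumBound k * ε * ∏ i ∈ B, b i) * ∏ i ∈ T \ B, b i :=
        mul_le_mul (ih B hBS hcard) (hm _ hDS) (abs_nonneg _) (by positivity)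
      have h2 : |ac m' a B| * |m (T \ B) - m' (T \ B)| ≤ (cumBound k * ∏ i ∈ B, b i) * (ε * ∏ i ∈ T \ B, b i) :=
        mul_le_mul (abs_ac_le_of_card_le hb hm' a k B hBS hcard) (hd _ hDS) (abs_nonneg _) (by positivity)
      calc |ac m a B * m (T \ B) - ac m' a B * m' (T \ B)|
          = |(ac m a B - ac m' a B) * m (T \ B) + ac m' a B * (m (T \ B) - m' (T \ B))| := by ring_nf
        _ ≤ |ac m a B - ac m' a B| * |m (T \ B)| + |ac m' a B| * |m (T \ B) - m' (T \ B)| := by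
            refine (abs_add_le _ _).trans ?_
            rw [abs_mul, abs_mul]
        _ ≤ (cumBound k * ε * ∏ i ∈ B, b i) * ∏ i ∈ T \ B, b i +
            (cumBound k * ∏ i ∈ B, b i) * (ε * ∏ i ∈ T \ B, b i) := add_le_add h1 h2
        _ = (cumBound k + cumBound k) * ε * ∏ i ∈ T, b i := by rw [← e]; ring
    rw [ac_eq, ac_eq]
    calc |m T - ∑ B ∈ apsub a T, ac m a B * m (T \ B) - (m' T - ∑ B ∈ apsub a T, ac m' a B * m' (T \ B))|
        = |(m T - m' T) - ∑ B ∈ apsub a T, (ac m a B * m (T \ B) - ac m' a B * m' (T \ B))| := by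
          rw [Finset.sum_sub_distrib]; ring_nf
      _ ≤ |m T - m' T| + |∑ B ∈ apsub a T, (ac m a B * m (T \ B) - ac m' a B * m' (T \ B))| := abs_sub _ _
      _ ≤ ε * (∏ i ∈ T, b i) + ∑ B ∈ apsub a T, |ac m a B * m (T \ B) - ac m' a B * m' (T \ B)| :=
          add_le_add (hd T hTS) (Finset.abs_sum_le_sum_abs _ _)
      _ ≤ ε * (∏ i ∈ T, b i) + ∑ B ∈ apsub a T, (cumBound k + cumBound k) * ε * ∏ i ∈ T, b i := by
          gcongr with B hB
          exact hterm B hB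
      _ = ε * (∏ i ∈ T, b i) + (apsub a T).card * ((cumBound k + cumBound k) * ε * ∏ i ∈ T, b i) := by
          rw [Finset.sum_const, nsmul_eq_mul]
      _ ≤ ε * (∏ i ∈ T, b i) + 2 ^ (k + 1) * ((cumBound k + cumBound k) * ε * ∏ i ∈ T, b i) := by
          gcongr
          exact (card_apsub_le a T).trans (pow_le_pow_right₀ (by norm_num) hTk)
      _ ≤ cumBound (k + 1) * ε * ∏ i ∈ T, b i := by
          have h := cumBound_succ_ge k
          have hεP : 0 ≤ ε * ∏ i ∈ T, b i := mul_nonneg hε hP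
          nlinarith [mul_nonneg (mul_nonneg (pow_nonneg (show (0:ℝ) ≤ 2 by norm_num) (k + 1))
            (add_nonneg hck hck)) hεP]

/-- **Lipschitz dependence on the moments** (non-cumulative form). [folklore] -/
theorem abs_ac_sub_ac_le {m m' : Finset ι → ℝ} {S : Finset ι} {b : ι → ℝ} {ε : ℝ}
    (hb : ∀ i, 0 ≤ b i) (hε : 0 ≤ ε)
    (hm : ∀ T ⊆ S, |m T| ≤ ∏ i ∈ T, b i) (hm' : ∀ T ⊆ S, |m' T| ≤ ∏ i ∈ T, b i)
    (hd : ∀ T ⊆ S, |m T - m' T| ≤ ε * ∏ i ∈ T, b i) (a : ι) {T : Finset ι} (hTS : T ⊆ S) :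
    |ac m a T - ac m' a T| ≤ cumBound T.card * ε * ∏ i ∈ T, b i :=
  abs_ac_sub_ac_le_of_card_le hb hε hm hm' hd a T.card T hTS le_rfl

/-! ### §3 Decoupled moments have no mixed cumulants; the split lemma -/

/-- ★ **Independent blocks have no mixed anchored cumulants**: if below `S` the moment function factorises across
the bipartition by a predicate `p` — `M T = M (T.filter p) · M (T.filter ¬p)` — and `M ∅ = 1`, then for every
`T ⊆ S` containing the anchor `a` (with `p a`) and meeting the `¬p` side, `ac M a T = 0`. [folklore] -/
theorem ac_eq_zero_of_factor (p : ι → Prop) [DecidablePred p] {M : Finset ι → ℝ} {S : Finset ι} (h1 : M ∅ = 1)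
    (hM : ∀ T ⊆ S, M T = M (T.filter p) * M (T.filter fun i => ¬p i)) {a : ι} (hpa : p a) :
    ∀ T ⊆ S, a ∈ T → (T.filter fun i => ¬p i).Nonempty → ac M a T = 0 := by
  intro T
  induction T using Finset.strongInduction with
  | H T ih =>
    intro hTS haT hTn
    rw [ac_eq, ← Finset.sum_filter_add_sum_filter_not (apsub a T) (fun B => ∀ i ∈ B, p i)]
    -- the blocks meeting the `¬p` side contribute nothing (induction hypothesis)
    have hzero : ∑ B ∈ (apsub a T).filter (fun B => ¬∀ i ∈ B, p i), ac M a B * M (T \ B) = 0 := by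
      refine Finset.sum_eq_zero fun B hB => ?_
      obtain ⟨hB, hnp⟩ := Finset.mem_filter.1 hB
      obtain ⟨hBT, haB, -⟩ := mem_apsub.1 hB
      have hnp' : ∃ i ∈ B, ¬p i := by
        by_contra hc
        exact hnp fun i hi => by_contra fun hpi => hc ⟨i, hi, hpi⟩
      obtain ⟨i, hiB, hpi⟩ := hnp'
      rw [ih B (ssubset_of_mem_apsub hB) (hBT.trans hTS) haB ⟨i, Finset.mem_filter.2 ⟨hiB, hpi⟩⟩, zero_mul]
    -- the blocks inside the `p` side reproduce `M (T.filter p)` by the recursion identity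
    set Tp := T.filter p with hTp
    set Tn := T.filter (fun i => ¬p i) with hTn'
    have hset : (apsub a T).filter (fun B => ∀ i ∈ B, p i) = Tp.powerset.filter (fun B => a ∈ B) := by
      ext B
      simp only [Finset.mem_filter, Finset.mem_powerset, mem_apsub, hTp]
      constructor
      · rintro ⟨⟨hBT, haB, -⟩, hall⟩
        exact ⟨fun i hi => Finset.mem_filter.2 ⟨hBT hi, hall i hi⟩, haB⟩
      · rintro ⟨hBp, haB⟩
        have hBT : B ⊆ T := fun i hi => (Finset.mem_filter.1 (hBp hi)).1
        have hall : ∀ i ∈ B, p i := fun i hi => (Finset.mem_filter.1 (hBp hi)).2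
        obtain ⟨j, hj⟩ := hTn
        have hjB : j ∉ B := fun h => (Finset.mem_filter.1 hj).2 (hall j h)
        exact ⟨⟨hBT, haB, fun h => hjB (h ▸ (Finset.mem_filter.1 hj).1)⟩, hall⟩
    have hinner : ∀ B ∈ Tp.powerset.filter (fun B => a ∈ B), ac M a B * M (T \ B) = (ac M a B * M (Tp \ B)) * M Tn := by
      intro B hB
      obtain ⟨hBp, -⟩ := Finset.mem_filter.1 hB
      rw [Finset.mem_powerset] at hBp
      have hall : ∀ i ∈ B, p i := fun i hi => (Finset.mem_filter.1 (hBp hi)).2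
      have e1 : (T \ B).filter p = Tp \ B := by
        ext i; simp only [Finset.mem_filter, Finset.mem_sdiff, hTp]; tauto
      have e2 : (T \ B).filter (fun i => ¬p i) = Tn := by
        ext i
        simp only [Finset.mem_filter, Finset.mem_sdiff, hTn']
        constructor
        · rintro ⟨⟨hiT, -⟩, hnp⟩; exact ⟨hiT, hnp⟩
        · rintro ⟨hiT, hnp⟩; exact ⟨⟨hiT, fun hiB => hnp (hall i hiB)⟩, hnp⟩
      rw [hM (T \ B) (Finset.sdiff_subset.trans hTS), e1, e2]
      ring
    have haTp : a ∈ Tp := Finset.mem_filter.2 ⟨haT, hpa⟩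
    rw [hzero, add_zero, hset, Finset.sum_congr rfl hinner, ← Finset.sum_mul, sum_ac_mul_eq M h1 haTp,
      hM T hTS]
    ring

/-- ★ **THE SPLIT LEMMA**: if below `S` the moments are bounded by `∏ b` and every moment factorises across the
bipartition by `p` up to `ε ∏ b` (`|m T − m(T_p) m(T_{¬p})| ≤ ε ∏_T b`), `m ∅ = 1`, and `S` contains the anchor and
meets both sides, then `|ac m a S| ≤ cumBound |S| · ε · ∏_{i∈S} b_i` — the anchored cumulant of two almost
independent blocks is small (exact decoupling `ac_eq_zero_of_factor` + Lipschitz dependence `abs_ac_sub_ac_le`). -/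
theorem abs_ac_le_of_split (p : ι → Prop) [DecidablePred p] {m : Finset ι → ℝ} {S : Finset ι} {a : ι}
    {b : ι → ℝ} {ε : ℝ} (hb : ∀ i, 0 ≤ b i) (hε : 0 ≤ ε) (h1 : m ∅ = 1)
    (hm : ∀ T ⊆ S, |m T| ≤ ∏ i ∈ T, b i)
    (hsplit : ∀ T ⊆ S, |m T - m (T.filter p) * m (T.filter fun i => ¬p i)| ≤ ε * ∏ i ∈ T, b i)
    (ha : a ∈ S) (hSp : (S.filter p).Nonempty) (hSn : (S.filter fun i => ¬p i).Nonempty) :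
    |ac m a S| ≤ cumBound S.card * ε * ∏ i ∈ S, b i := by
  -- the decoupled moment function
  set M : Finset ι → ℝ := fun T => m (T.filter p) * m (T.filter fun i => ¬p i) with hMdef
  have hM1 : M ∅ = 1 := by simp [hMdef, h1]
  have hMb : ∀ T ⊆ S, |M T| ≤ ∏ i ∈ T, b i := by
    intro T hTS
    rw [hMdef, abs_mul, ← Finset.prod_filter_mul_prod_filter_not T p]
    exact mul_le_mul (hm _ ((Finset.filter_subset _ _).trans hTS)) (hm _ ((Finset.filter_subset _ _).trans hTS))
      (abs_nonneg _) (Finset.prod_nonneg fun i _ => hb i)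
  have hMM : ∀ T ⊆ S, M T = M (T.filter p) * M (T.filter fun i => ¬p i) := by
    intro T _
    simp only [hMdef, Finset.filter_filter]
    have e1 : T.filter (fun i => p i ∧ ¬p i) = ∅ := by
      ext i; simp
    have e2 : T.filter (fun i => ¬p i ∧ p i) = ∅ := by
      ext i; simp only [Finset.mem_filter, Finset.notMem_empty, iff_false]; tauto
    have e3 : T.filter (fun i => p i ∧ p i) = T.filter p := by
      ext i; simp
    have e4 : T.filter (fun i => ¬p i ∧ ¬p i) = T.filter (fun i => ¬p i) := by
      ext i; simp
    rw [e1, e2, e3, e4, h1]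
    ring
  have hvan : ac M a S = 0 := by
    by_cases hpa : p a
    · exact ac_eq_zero_of_factor p hM1 hMM hpa S subset_rfl ha hSn
    · -- anchor on the `¬p` side: use the symmetric factorisation
      have hMM' : ∀ T ⊆ S, M T = M (T.filter fun i => ¬p i) * M (T.filter fun i => ¬¬p i) := by
        intro T hTS
        have e : T.filter (fun i => ¬¬p i) = T.filter p := Finset.filter_congr fun i _ => not_not
        rw [e, mul_comm]
        exact hMM T hTS
      have hSp' : (S.filter fun i => ¬¬p i).Nonempty := by
        have e : S.filter (fun i => ¬¬p i) = S.filter p := Finset.filter_congr fun i _ => not_not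
        rw [e]; exact hSp
      exact ac_eq_zero_of_factor (fun i => ¬p i) hM1 hMM' hpa S subset_rfl ha hSp'
  have h := abs_ac_sub_ac_le hb hε hm hMb (fun T hTS => hsplit T hTS) a (subset_rfl : S ⊆ S)
  rwa [hvan, sub_zero] at h

end Summit.Ventures.YMGap.Cumulants

end
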